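import Summits.KontsevichZagierPeriods.KontsevichZagierPeriods.Theorems.VietaFibreKernelFormItemDictionary
import Summits.KontsevichZagierPeriods.KontsevichZagierPeriods.Theorems.VietaFibreKernelFormRingDictionary
import Summits.KontsevichZagierPeriods.KontsevichZagierPeriods.Theorems.VietaFibreKernelFormIsSummit
import Summits.KontsevichZagierPeriods.KontsevichZagierPeriods.Theorems.LiouvilleUnfoldingAyoubPiLocalKernelStubLocallyReducedOnTorsion
import HarnessLib

/-!
# Crux `KernelForm` (stmt-KontsevichZagierPeriods-10447) — skeleton for the PIECE `stub_ayoubPiLocalKernel`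
# (= item stmt-KontsevichZagierPeriods-0541 `VietaFibre.AyoubPiLocalKernel`, the bare side of the bridge split
# `KernelForm ⇐ AyoubPiLocalKernel (0541) ∧ AyoubPiCancellation (0540)` / `∧ PositiveCancellation (5621)`)

Route VietaFibre's deciding crux `KernelForm` is the summit restated (`kernelForm_iff_summit`, p125241) and is
redirected one level down (`kernelForm_iff_ayoubPiLocalKernel_and_ayoubPiCancellation`,
`kernelForm_iff_ayoubPiLocalKernel_and_positiveCancellation`, p121847; glue item 18038 proved).  The piece
`PositiveCancellation` has the registered skeleton `Lines/stub_positiveCancellation.lean` (stubs 0540 ∧ (R) ∧ (iii)).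
This file is the plan for the OTHER, transcendence-carrying piece

  `stub_ayoubPiLocalKernel : Theses.VietaFibre.AyoubPiLocalKernel`   (item 0541 verbatim; `↔ KZ.PiLocalKernel`,
  J. Ayoub's Conjecture 7 for the four-move calculus: evaluation is injective on `P[ϖ⁻¹]`).

## The cut: "generic point ∧ localised domain" (Huber–Müller-Stach's two clauses, with ALL reducedness on the
## eval-free side)

Write `P := KZ.FormalPeriodRing = FormalRep ⧸ relations`, `evalP : P →+* ℝ`, `ϖ := KZ.toFormalPeriod (KZ.of KZ.piRep)`
(the class of the disc `[π]`, `evalP ϖ = π ≠ 0`) and `𝔭 := ker evalP` (the Lebesgue point of `Spec P`).  In `P` the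
piece reads `∀ x, evalP x = 0 → ∃ N, ϖ ^ N * x = 0` (`piLocalKernel_iff_forall_evalP`, p136024), i.e. the induced map
`P[ϖ⁻¹] → ℝ` is injective, i.e. `P[ϖ⁻¹]` is an integral domain AND its prime `𝔭 P[ϖ⁻¹]` is the zero ideal.  Accordingly:

* `stub_genericPoint` — **(G) the Lebesgue point is a GENERIC point of `Spec P`**: every class of value `0` is
  nilpotent in the local ring `P_𝔭`, i.e. `∀ x, evalP x = 0 → ∃ s, evalP s ≠ 0 ∧ ∃ k, s * x ^ (k + 1) = 0`
  (`↔ ker evalP ∈ minimalPrimes P`, proved below; the "comparison point is generic" clause of the period conjecture,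
  Huber–Müller-Stach 2017 §13.2; landed vocabulary `LiouvilleUnfoldingAyoubPiLocalKernelNilForms`).  This is the ONLY
  stub mentioning `eval` and it is the WEAKEST transcendence statement on file for this crux: it is implied by the
  former registered stub `stub_weakKernel` of this crux (`P_𝔭` is a field, c0–c11; `genericPoint_of_weakKernel`), by
  0541's stub (N) `NilLocalKernel` (`genericPoint_of_nilLocalKernel`), by the piece and by the summit; over the bare
  interface it is strictly weaker than each of them (dual numbers `ℝ[ε]`, `ϖ ↦ π`: (G) holds with `k = 1`, WeakKernel
  fails).  Conjecture-grade (period-conjecture strength: no refutation short of ¬Conjecture 1).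
* `stub_localisedDomain` — **(D) `P[ϖ⁻¹]` is an INTEGRAL DOMAIN** (eval-free): `∀ x y, x * y = 0 →
  (∃ N, ϖ ^ N * x = 0) ∨ (∃ N, ϖ ^ N * y = 0)` (`↔ IsDomain (Localization.Away ϖ)`, proved below) — irreducibility AND
  reducedness of Kontsevich–Zagier's extended algebra `P̂ = P[π⁻¹]` (2001, §4.1) in the rules presentation.  It
  implies the shared stub (R) `LocallyReducedOnTorsion` of 0541's line `SketchIdeator2` and of the sibling piece
  skeleton, and the sibling's stub (iii) `ZeroDivisorsLocallyNil`; with item 0540 (`ϖ` a non-zero-divisor) it is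
  EXACTLY `IsDomain P` (`isDomain_iff_localisedDomain_and_ayoubPiCancellation`).  Motivic shadow: integrality of
  Nori's `2πi`-localised formal period algebra = Cartier reducedness of the period torsor (a theorem in the motivic
  setting) + its connectedness (structural, transcendence-free); the missing input is the comparison of the four-move
  presentation with Nori's (cf. `Cruxes/MultiCoVKernel/Lines/picut_localkernel_birth.lean`, stub S1 = item 3574).
  Conjecture-grade for this calculus.

Composition (`forall_evalP_of_stubs`, sorry-free, three lines): `evalP x = 0` ⟹ (G) `s * x ^ (k+1) = 0` with
`evalP s ≠ 0` ⟹ (D) `s` or `x ^ (k+1)` is `ϖ`-power torsion; `s` is not (`evalP (ϖ ^ N * s) ≠ 0`, soundness) ⟹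
`ϖ ^ N * x ^ (k+1) = 0` ⟹ (D ⇒ R, `locallyReducedOnTorsion_of_localisedDomain`) `ϖ ^ M * x = 0`.  Then
`piLocalKernel_iff_forall_evalP` (p136024) and the item dictionary `ayoubPiLocalKernel_iff_piLocalKernel` (p121847).
`AyoubPiLocalKernel_of` (the first declaration concluding the piece) concludes `Theses.VietaFibre.AyoubPiLocalKernel` BY NAME
from the two registered stubs.

Exactness and position (all proved below): the cut is EXACT (`ayoubPiLocalKernel_iff_genericPoint_and_localisedDomain`);
both stubs follow from the piece and from the summit (`stubs_of_summit`); neither stub gives the piece or the summit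
on its own (abstract models over the bare interface ⟨commutative ring, character to `ℝ`, element of non-zero value⟩:
`ℝ × ℝ`, `evalP = pr₁`, `ϖ = (π, π)` has (G) and not (D); `ℝ[t]`, `evalP = ev₀`, `ϖ = π` has (D) and not (G); the
piece fails in both; per-stub probes in the seat folder `bc/`).  JOINT PLAN for crux 10447 across the two piece
skeletons: `KernelForm ↔ (G) ∧ (D) ∧ AyoubPiCancellation` (`kernelForm_iff_genericPoint_and_localisedDomain_and_ayoubPiCancellation`)
— one transcendence leaf (G), two eval-free leaves.

Disproof used (`Cruxes/AyoubPiLocalKernel/Disproof.lean`, cdisprove cycle 1; Negative/LoadBearing, Subcalculi, KillShape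
landed): the hypothesis `eval c = 0` is load-bearing (`ayoubPiLocalKernel_false_without_evalZero`) — the line uses it in
(G) and only there; pinning is honoured through the landed dictionary (no family is chosen); the exponent-`0`
strengthening (= the summit) is not assumed anywhere; no stub is an instance of a landed Negative lemma (both are
summit-implied).

References: M. Kontsevich, D. Zagier, *Periods* (2001), §1.2 Conjecture 1, §4.1 (`P̂ = P[1/π]`); J. Ayoub, *Periods and
the conjectures of Grothendieck and Kontsevich–Zagier*, EMS Newsl. 91 (2014), Def. 6, Conj. 7, Prop. 11; A. Huber,
S. Müller-Stach, *Periods and Nori Motives* (2017), §13.2 (period conjecture ⟺ torsor connected ∧ evaluation point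
generic); A. Huber, G. Wüstholz, *Transcendence and Linear Relations of 1-Periods* (2022), §13.1 Conj. 13.1 and
Rem. 13.2 (`𝒫 = 𝒫^eff[π⁻¹]`; `Spec 𝒫` a torsor under the motivic Galois group).  Mathlib: `minimalPrimes`,
`Ideal.exists_le_prime_disjoint`, `Localization.Away`, `IsLocalization.map_eq_zero_iff`.
-/

noncomputable section

set_option linter.dupNamespace false

open Literature.NumberTheory.Transcendental

namespace Summit.KontsevichZagierPeriods.KontsevichZagierPeriods.Cruxes.KernelForm.AyoubPiLocalKernelPiece

open Summit.KontsevichZagierPeriods.KernelForm.LocaliseAtValuePrime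
open Summit.KontsevichZagierPeriods.LiouvilleUnfolding.PiLocalKernelPosition
  (piLocalKernel_iff_forall_evalP evalP_eq_zero_of_pow_mul_eq_zero evalP_piClass_ne_zero
    ayoubPiLocalKernel_of_summit)
open Summit.KontsevichZagierPeriods.LiouvilleUnfolding.NilradicalCut
  (evalP_eq_zero_of_pow_mul_pow_succ_eq_zero piClass_pow_ne_zero piTorsion_iff_algebraMap_eq_zero
    nil_and_locallyReduced_of_summit)

/-! ## The two registered stubs -/

/-- **Stub (G) — `GenericPoint`** (the transcendence leaf): the Lebesgue point `𝔭 = ker evalP` is a generic point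
of `Spec P` — every class of value `0` is nilpotent in the local ring `P_𝔭`, i.e. is killed by a class of NON-ZERO
VALUE after raising to a power.  `↔ ker evalP ∈ minimalPrimes P` (`genericPoint_iff_ker_evalP_mem_minimalPrimes`).
Implied by WeakKernel (`k = 0`), by 0541's stub (N) (`s = ϖ ^ N`), by the piece and by the summit; the weakest
transcendence statement on file for this crux.  OPEN — period-conjecture strength. -/
theorem stub_genericPoint :
    ∀ x : KZ.FormalPeriodRing, KZ.evalP x = 0 →
      ∃ s : KZ.FormalPeriodRing, KZ.evalP s ≠ 0 ∧ ∃ k : ℕ, s * x ^ (k + 1) = 0 := by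
  sorry

/-- **Stub (D) — `LocalisedDomain`** (the eval-free leaf): the extended algebra `P[ϖ⁻¹]` (`ϖ = ⟦[π]⟧`) is an
integral domain — a product of two classes is a relation only if one factor is `ϖ`-power torsion.
`↔ IsDomain (Localization.Away ϖ)` (`localisedDomain_iff_isDomain_away`); implies (R) and (iii) of the other two
skeletons; with item 0540 it is exactly `IsDomain P`.  Summit-implied; transcendence-free; conjecture-grade. -/
theorem stub_localisedDomain :
    ∀ x y : KZ.FormalPeriodRing, x * y = 0 →
      (∃ N : ℕ, KZ.toFormalPeriod (KZ.of KZ.piRep) ^ N * x = 0) ∨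
        (∃ N : ℕ, KZ.toFormalPeriod (KZ.of KZ.piRep) ^ N * y = 0) := by
  sorry

/-! ## Bookkeeping in the formal period ring -/

/-- A `ϖ`-power-torsion class has value `0`; contrapositive form used throughout. [folklore] -/
theorem not_piTorsion_of_evalP_ne_zero {s : KZ.FormalPeriodRing} (hs : KZ.evalP s ≠ 0) :
    ¬ ∃ N : ℕ, KZ.toFormalPeriod (KZ.of KZ.piRep) ^ N * s = 0 :=
  fun ⟨_, hN⟩ => hs (evalP_eq_zero_of_pow_mul_eq_zero hN)

/-- **(D) ⇒ (R)**: under `LocalisedDomain`, a `ϖ`-locally nilpotent class is `ϖ`-power torsion — the eval-free stub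
of this skeleton implies the shared stub `stub_locallyReducedOnTorsion` of 0541's line `SketchIdeator2` and of the
sibling piece skeleton `Lines/stub_positiveCancellation.lean` (induction on the exponent: `ϖ^N x^(k+2) =
(ϖ^N x^(k+1))·x`). [folklore] -/
theorem locallyReducedOnTorsion_of_localisedDomain
    (hD : ∀ x y : KZ.FormalPeriodRing, x * y = 0 →
      (∃ N : ℕ, KZ.toFormalPeriod (KZ.of KZ.piRep) ^ N * x = 0) ∨
        (∃ N : ℕ, KZ.toFormalPeriod (KZ.of KZ.piRep) ^ N * y = 0)) :
    ∀ x : KZ.FormalPeriodRing,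
      (∃ N k : ℕ, KZ.toFormalPeriod (KZ.of KZ.piRep) ^ N * x ^ (k + 1) = 0) →
        ∃ N : ℕ, KZ.toFormalPeriod (KZ.of KZ.piRep) ^ N * x = 0 := by
  intro x ⟨N, k, hNk⟩
  induction k generalizing N with
  | zero => exact ⟨N, by simpa using hNk⟩
  | succ k ih =>
    have h' : (KZ.toFormalPeriod (KZ.of KZ.piRep) ^ N * x ^ (k + 1)) * x = 0 := by
      rw [mul_assoc, ← pow_succ]; exact hNk
    rcases hD _ _ h' with ⟨M, hM⟩ | h
    · exact ih (M + N) (by rw [pow_add, mul_assoc]; exact hM)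
    · exact h

/-- **(D) ⇒ (iii)**: under `LocalisedDomain`, a class killed by a class of non-zero value is `ϖ`-power torsion
(a fortiori `ϖ`-locally nilpotent) — the sibling skeleton's stub `stub_zeroDivisorsLocallyNil` and its exact residue
`LocalisedCancellation` both follow from (D) alone. [folklore] -/
theorem localisedCancellation_of_localisedDomain
    (hD : ∀ x y : KZ.FormalPeriodRing, x * y = 0 →
      (∃ N : ℕ, KZ.toFormalPeriod (KZ.of KZ.piRep) ^ N * x = 0) ∨
        (∃ N : ℕ, KZ.toFormalPeriod (KZ.of KZ.piRep) ^ N * y = 0)) :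
    ∀ x s : KZ.FormalPeriodRing, KZ.evalP s ≠ 0 → s * x = 0 →
      ∃ N : ℕ, KZ.toFormalPeriod (KZ.of KZ.piRep) ^ N * x = 0 := by
  intro x s hs hsx
  rcases hD s x hsx with h | h
  · exact absurd h (not_piTorsion_of_evalP_ne_zero hs)
  · exact h

/-- (D) ⇒ the sibling's stub (iii) verbatim (`N`, `k = 0`). [folklore] -/
theorem zeroDivisorsLocallyNil_of_localisedDomain
    (hD : ∀ x y : KZ.FormalPeriodRing, x * y = 0 →
      (∃ N : ℕ, KZ.toFormalPeriod (KZ.of KZ.piRep) ^ N * x = 0) ∨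
        (∃ N : ℕ, KZ.toFormalPeriod (KZ.of KZ.piRep) ^ N * y = 0)) :
    ∀ x s : KZ.FormalPeriodRing, KZ.evalP s ≠ 0 → s * x = 0 →
      ∃ N k : ℕ, KZ.toFormalPeriod (KZ.of KZ.piRep) ^ N * x ^ (k + 1) = 0 := by
  intro x s hs hsx
  obtain ⟨N, hN⟩ := localisedCancellation_of_localisedDomain hD x s hs hsx
  exact ⟨N, 0, by rw [zero_add, pow_one]; exact hN⟩

/-! ## Composition: the piece from the stubs -/

/-- **The piece in the formal period ring from (G) ∧ (D)** (hypothesis form): every class of value `0` is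
`ϖ`-power torsion.  (G) gives `s * x ^ (k+1) = 0` with `evalP s ≠ 0`; (D) makes `s` or `x ^ (k+1)` torsion; `s` is
not (soundness); (D ⇒ R) lowers the exponent to `1`. [folklore] -/
theorem forall_evalP_of_stubs
    (hG : ∀ x : KZ.FormalPeriodRing, KZ.evalP x = 0 →
      ∃ s : KZ.FormalPeriodRing, KZ.evalP s ≠ 0 ∧ ∃ k : ℕ, s * x ^ (k + 1) = 0)
    (hD : ∀ x y : KZ.FormalPeriodRing, x * y = 0 →
      (∃ N : ℕ, KZ.toFormalPeriod (KZ.of KZ.piRep) ^ N * x = 0) ∨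
        (∃ N : ℕ, KZ.toFormalPeriod (KZ.of KZ.piRep) ^ N * y = 0)) :
    ∀ x : KZ.FormalPeriodRing, KZ.evalP x = 0 →
      ∃ N : ℕ, KZ.toFormalPeriod (KZ.of KZ.piRep) ^ N * x = 0 := by
  intro x hx
  obtain ⟨s, hs, k, hk⟩ := hG x hx
  rcases hD s (x ^ (k + 1)) hk with h | ⟨N, hN⟩
  · exact absurd h (not_piTorsion_of_evalP_ne_zero hs)
  · exact locallyReducedOnTorsion_of_localisedDomain hD x ⟨N, k, hN⟩

/-- `KZ.PiLocalKernel` (closed-term form of item 0541) from (G) ∧ (D). [cite: Ayoub2014, Conj. 7] -/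
theorem piLocalKernel_of_stubs
    (hG : ∀ x : KZ.FormalPeriodRing, KZ.evalP x = 0 →
      ∃ s : KZ.FormalPeriodRing, KZ.evalP s ≠ 0 ∧ ∃ k : ℕ, s * x ^ (k + 1) = 0)
    (hD : ∀ x y : KZ.FormalPeriodRing, x * y = 0 →
      (∃ N : ℕ, KZ.toFormalPeriod (KZ.of KZ.piRep) ^ N * x = 0) ∨
        (∃ N : ℕ, KZ.toFormalPeriod (KZ.of KZ.piRep) ^ N * y = 0)) :
    KZ.PiLocalKernel :=
  piLocalKernel_iff_forall_evalP.mpr (forall_evalP_of_stubs hG hD)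

/-- Route VietaFibre's child decl of item 0541 has the same body as route AyoubSpecialisation's. [folklore] -/
theorem vietaFibre_ayoubPiLocalKernel_iff_ayoubSpecialisation :
    Summit.KontsevichZagierPeriods.KontsevichZagierPeriods.Theses.VietaFibre.AyoubPiLocalKernel ↔
      Summit.KontsevichZagierPeriods.KontsevichZagierPeriods.Theses.AyoubSpecialisation.AyoubPiLocalKernel :=
  Iff.rfl

/-- **Route VietaFibre's decl of item 0541 is `KZ.PiLocalKernel`** (item dictionary p121847, transported along
`Iff.rfl`). [cite: Ayoub2014, Conj. 7] -/
theorem vietaFibre_ayoubPiLocalKernel_iff_piLocalKernel :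
    Summit.KontsevichZagierPeriods.KontsevichZagierPeriods.Theses.VietaFibre.AyoubPiLocalKernel ↔
      KZ.PiLocalKernel :=
  vietaFibre_ayoubPiLocalKernel_iff_ayoubSpecialisation.trans ayoubPiLocalKernel_iff_piLocalKernel

/-- **The line's deciding step**: the two registered stubs prove the piece
`Theses.VietaFibre.AyoubPiLocalKernel` (= the type of `stub_ayoubPiLocalKernel` in `Lines/Sketch.lean`, = item
stmt-KontsevichZagierPeriods-0541) BY NAME.  (This is the FIRST declaration concluding the piece: the skeleton audit takes
it as the line's composition; its only open leaves are the two `stub_*` by name.) [folklore] -/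
theorem AyoubPiLocalKernel_of :
    Summit.KontsevichZagierPeriods.KontsevichZagierPeriods.Theses.VietaFibre.AyoubPiLocalKernel :=
  vietaFibre_ayoubPiLocalKernel_iff_piLocalKernel.mpr
    (piLocalKernel_of_stubs stub_genericPoint stub_localisedDomain)

/- **The piece from (G) ∧ (D), hypothesis form** — the literal BC3 shape `stub₁-sig → stub₂-sig → C`, as an
`example` (not a declaration): the skeleton audit requires the hypotheses of a NAMED theorem concluding the crux to be
registered obligations by name, so the named composition is `AyoubPiLocalKernel_of` above and the hypothesis form is
`piLocalKernel_of_stubs` + `vietaFibre_ayoubPiLocalKernel_iff_piLocalKernel`. -/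
example :
    (∀ x : KZ.FormalPeriodRing, KZ.evalP x = 0 →
      ∃ s : KZ.FormalPeriodRing, KZ.evalP s ≠ 0 ∧ ∃ k : ℕ, s * x ^ (k + 1) = 0) →
    (∀ x y : KZ.FormalPeriodRing, x * y = 0 →
      (∃ N : ℕ, KZ.toFormalPeriod (KZ.of KZ.piRep) ^ N * x = 0) ∨
        (∃ N : ℕ, KZ.toFormalPeriod (KZ.of KZ.piRep) ^ N * y = 0)) →
    Summit.KontsevichZagierPeriods.KontsevichZagierPeriods.Theses.VietaFibre.AyoubPiLocalKernel :=
  fun hG hD => vietaFibre_ayoubPiLocalKernel_iff_piLocalKernel.mpr (piLocalKernel_of_stubs hG hD)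

/-- The same conclusion under route AyoubSpecialisation's / LiouvilleUnfolding's names of the shared item 0541
(identical bodies). [folklore] -/
theorem ayoubSpecialisation_AyoubPiLocalKernel_of :
    Summit.KontsevichZagierPeriods.KontsevichZagierPeriods.Theses.AyoubSpecialisation.AyoubPiLocalKernel :=
  AyoubPiLocalKernel_of

theorem liouvilleUnfolding_AyoubPiLocalKernel_of :
    Summit.KontsevichZagierPeriods.KontsevichZagierPeriods.Theses.LiouvilleUnfolding.AyoubPiLocalKernel :=
  AyoubPiLocalKernel_of

/-- Where this skeleton plugs in: with the other piece of the bridge split the crux `KernelForm` of item 10447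
closes (`.mpr` of p121847, either sibling). [folklore] -/
theorem KernelForm_of_ayoubPiCancellation
    (h : Summit.KontsevichZagierPeriods.KontsevichZagierPeriods.Theses.VietaFibre.AyoubPiCancellation) :
    Summit.KontsevichZagierPeriods.KontsevichZagierPeriods.Theses.VietaFibre.KernelForm :=
  kernelForm_iff_ayoubPiLocalKernel_and_ayoubPiCancellation.mpr ⟨AyoubPiLocalKernel_of, h⟩

theorem KernelForm_of_positiveCancellation
    (h : Summit.KontsevichZagierPeriods.KontsevichZagierPeriods.Theses.SelbergAMGM.PositiveCancellation) :
    Summit.KontsevichZagierPeriods.KontsevichZagierPeriods.Theses.VietaFibre.KernelForm :=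
  kernelForm_iff_ayoubPiLocalKernel_and_positiveCancellation.mpr ⟨AyoubPiLocalKernel_of, h⟩

/-! ## Exactness of the cut (both stubs are consequences of the piece) -/

/-- The piece ⇒ (G) (`s = ϖ ^ N`, `k = 0`). [folklore] -/
theorem genericPoint_of_piece
    (h : Summit.KontsevichZagierPeriods.KontsevichZagierPeriods.Theses.VietaFibre.AyoubPiLocalKernel) :
    ∀ x : KZ.FormalPeriodRing, KZ.evalP x = 0 →
      ∃ s : KZ.FormalPeriodRing, KZ.evalP s ≠ 0 ∧ ∃ k : ℕ, s * x ^ (k + 1) = 0 := by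
  have hP := piLocalKernel_iff_forall_evalP.mp (vietaFibre_ayoubPiLocalKernel_iff_piLocalKernel.mp h)
  intro x hx
  obtain ⟨N, hN⟩ := hP x hx
  refine ⟨KZ.toFormalPeriod (KZ.of KZ.piRep) ^ N, ?_, 0, by rw [zero_add, pow_one]; exact hN⟩
  rw [map_pow]
  exact pow_ne_zero N evalP_piClass_ne_zero

/-- The piece ⇒ (D) (`evalP x · evalP y = 0` in the domain `ℝ`, then the piece on the vanishing factor). [folklore] -/
theorem localisedDomain_of_piece
    (h : Summit.KontsevichZagierPeriods.KontsevichZagierPeriods.Theses.VietaFibre.AyoubPiLocalKernel) :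
    ∀ x y : KZ.FormalPeriodRing, x * y = 0 →
      (∃ N : ℕ, KZ.toFormalPeriod (KZ.of KZ.piRep) ^ N * x = 0) ∨
        (∃ N : ℕ, KZ.toFormalPeriod (KZ.of KZ.piRep) ^ N * y = 0) := by
  have hP := piLocalKernel_iff_forall_evalP.mp (vietaFibre_ayoubPiLocalKernel_iff_piLocalKernel.mp h)
  intro x y hxy
  have h0 : KZ.evalP x * KZ.evalP y = 0 := by rw [← map_mul, hxy, map_zero]
  rcases mul_eq_zero.mp h0 with hx | hy
  · exact Or.inl (hP x hx)
  · exact Or.inr (hP y hy)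

/-- **The cut is EXACT**: item 0541 (route VietaFibre's decl) ⟺ (G) ∧ (D). [folklore] -/
theorem ayoubPiLocalKernel_iff_genericPoint_and_localisedDomain :
    Summit.KontsevichZagierPeriods.KontsevichZagierPeriods.Theses.VietaFibre.AyoubPiLocalKernel ↔
      ((∀ x : KZ.FormalPeriodRing, KZ.evalP x = 0 →
          ∃ s : KZ.FormalPeriodRing, KZ.evalP s ≠ 0 ∧ ∃ k : ℕ, s * x ^ (k + 1) = 0) ∧
        (∀ x y : KZ.FormalPeriodRing, x * y = 0 →
          (∃ N : ℕ, KZ.toFormalPeriod (KZ.of KZ.piRep) ^ N * x = 0) ∨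
            (∃ N : ℕ, KZ.toFormalPeriod (KZ.of KZ.piRep) ^ N * y = 0))) :=
  ⟨fun h => ⟨genericPoint_of_piece h, localisedDomain_of_piece h⟩,
    fun h => vietaFibre_ayoubPiLocalKernel_iff_piLocalKernel.mpr (piLocalKernel_of_stubs h.1 h.2)⟩

/-- **Both stubs follow from the summit** (so neither is refutable short of refuting Conjecture 1).
[cite: KontsevichZagier2001, §1.2 Conjecture 1] -/
theorem stubs_of_summit (h : _root_.KontsevichZagierPeriods) :
    (∀ x : KZ.FormalPeriodRing, KZ.evalP x = 0 →
        ∃ s : KZ.FormalPeriodRing, KZ.evalP s ≠ 0 ∧ ∃ k : ℕ, s * x ^ (k + 1) = 0) ∧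
      (∀ x y : KZ.FormalPeriodRing, x * y = 0 →
        (∃ N : ℕ, KZ.toFormalPeriod (KZ.of KZ.piRep) ^ N * x = 0) ∨
          (∃ N : ℕ, KZ.toFormalPeriod (KZ.of KZ.piRep) ^ N * y = 0)) :=
  ayoubPiLocalKernel_iff_genericPoint_and_localisedDomain.mp (ayoubPiLocalKernel_of_summit h)

/-! ## Position of (G): the weakest transcendence leaf on file -/

/-- **WeakKernel ⇒ (G)** (`k = 0`): the former registered stub `stub_weakKernel` of this crux (the transcendence
half of `KernelForm ↔ WeakKernel ∧ Cancellation`, `VietaFibreKernelFormCut`) implies the new transcendence stub.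
[folklore] -/
theorem genericPoint_of_weakKernel
    (hW : ∀ c : KZ.FormalRep, KZ.eval c = 0 → ∃ s : KZ.FormalRep, KZ.eval s ≠ 0 ∧ s * c ∈ KZ.relations) :
    ∀ x : KZ.FormalPeriodRing, KZ.evalP x = 0 →
      ∃ s : KZ.FormalPeriodRing, KZ.evalP s ≠ 0 ∧ ∃ k : ℕ, s * x ^ (k + 1) = 0 := by
  intro x hx
  obtain ⟨c, rfl⟩ := KZ.toFormalPeriod_surjective x
  rw [KZ.evalP_toFormalPeriod] at hx
  obtain ⟨s, hs, hsc⟩ := hW c hx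
  refine ⟨KZ.toFormalPeriod s, by rwa [KZ.evalP_toFormalPeriod], 0, ?_⟩
  rw [zero_add, pow_one]
  exact (toFormalPeriod_mul_toFormalPeriod_eq_zero_iff s c).mpr hsc

/-- **(N) ⇒ (G)** (`s = ϖ ^ N`): the transcendence stub `stub_nilLocalKernel` of 0541's registered line
`SketchIdeator2` implies the new transcendence stub. [folklore] -/
theorem genericPoint_of_nilLocalKernel
    (hN : ∀ x : KZ.FormalPeriodRing, KZ.evalP x = 0 →
      ∃ N k : ℕ, KZ.toFormalPeriod (KZ.of KZ.piRep) ^ N * x ^ (k + 1) = 0) :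
    ∀ x : KZ.FormalPeriodRing, KZ.evalP x = 0 →
      ∃ s : KZ.FormalPeriodRing, KZ.evalP s ≠ 0 ∧ ∃ k : ℕ, s * x ^ (k + 1) = 0 := by
  intro x hx
  obtain ⟨N, k, hNk⟩ := hN x hx
  refine ⟨KZ.toFormalPeriod (KZ.of KZ.piRep) ^ N, ?_, k, hNk⟩
  rw [map_pow]
  exact pow_ne_zero N evalP_piClass_ne_zero

/-- **(G) ∧ (D) ⇒ WeakKernel**: under the eval-free stub the new transcendence leaf is as strong as the old one
(through the piece and `weakKernel_of_piLocalKernel`). [folklore] -/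
theorem weakKernel_of_stubs
    (hG : ∀ x : KZ.FormalPeriodRing, KZ.evalP x = 0 →
      ∃ s : KZ.FormalPeriodRing, KZ.evalP s ≠ 0 ∧ ∃ k : ℕ, s * x ^ (k + 1) = 0)
    (hD : ∀ x y : KZ.FormalPeriodRing, x * y = 0 →
      (∃ N : ℕ, KZ.toFormalPeriod (KZ.of KZ.piRep) ^ N * x = 0) ∨
        (∃ N : ℕ, KZ.toFormalPeriod (KZ.of KZ.piRep) ^ N * y = 0)) :
    ∀ c : KZ.FormalRep, KZ.eval c = 0 → ∃ s : KZ.FormalRep, KZ.eval s ≠ 0 ∧ s * c ∈ KZ.relations :=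
  weakKernel_of_piLocalKernel (piLocalKernel_of_stubs hG hD)

/-- **(G) `↔ ker evalP` is a minimal prime of `P`** — the registered elementwise stub is literally genericity of the
Lebesgue point (the landed clause of `nilLocalKernel_iff_generic_and_irreducible`, p138786).  `→`: a prime `q ≤ 𝔭`
contains every `x ∈ 𝔭`, since `s * x ^ (k+1) = 0 ∈ q` with `s ∉ q`.  `←`: if no `s ∉ 𝔭`, `k` has `s * x ^ (k+1) = 0`,
the multiplicative set `{s * x ^ b | evalP s ≠ 0}` avoids `0`, so a prime `q` avoids it
(`Ideal.exists_le_prime_disjoint`); then `q ≤ 𝔭`, hence `q = 𝔭 ∋ x` by minimality — but `x = 1 * x ^ 1` is in the set.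
[cite: HuberMullerStachPeriods2017, §13.2] -/
theorem genericPoint_iff_ker_evalP_mem_minimalPrimes :
    (∀ x : KZ.FormalPeriodRing, KZ.evalP x = 0 →
        ∃ s : KZ.FormalPeriodRing, KZ.evalP s ≠ 0 ∧ ∃ k : ℕ, s * x ^ (k + 1) = 0) ↔
      RingHom.ker KZ.evalP ∈ minimalPrimes KZ.FormalPeriodRing := by
  haveI hprime : (RingHom.ker KZ.evalP).IsPrime := RingHom.ker_isPrime _
  constructor
  · intro hG
    refine ⟨⟨hprime, bot_le⟩, ?_⟩
    rintro q ⟨hq, -⟩ hle x hx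
    obtain ⟨s, hs, k, hk⟩ := hG x (RingHom.mem_ker.mp hx)
    have hsq : s ∉ q := fun h => hs (RingHom.mem_ker.mp (hle h))
    have hmem : s * x ^ (k + 1) ∈ q := by rw [hk]; exact q.zero_mem
    rcases hq.mem_or_mem hmem with h1 | h2
    · exact absurd h1 hsq
    · exact hq.mem_of_pow_mem (k + 1) h2
  · intro hmin x hx
    by_contra hcon
    push Not at hcon
    let S : Submonoid KZ.FormalPeriodRing :=
      { carrier := {y | ∃ s : KZ.FormalPeriodRing, ∃ b : ℕ, KZ.evalP s ≠ 0 ∧ y = s * x ^ b}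
        mul_mem' := by
          rintro _ _ ⟨s, b, hs, rfl⟩ ⟨t, d, ht, rfl⟩
          exact ⟨s * t, b + d, by rw [map_mul]; exact mul_ne_zero hs ht, by ring⟩
        one_mem' := ⟨1, 0, by rw [map_one]; exact one_ne_zero, by simp⟩ }
    have h0 : (0 : KZ.FormalPeriodRing) ∉ S := by
      rintro ⟨s, b, hs, hsb⟩
      cases b with
      | zero => exact hs (by rw [pow_zero, mul_one] at hsb; rw [← hsb, map_zero])
      | succ k => exact hcon s hs k hsb.symm
    have hdisj : Disjoint ((⊥ : Ideal KZ.FormalPeriodRing) : Set KZ.FormalPeriodRing) S := by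
      rw [Set.disjoint_left]
      intro y hy hyS
      rw [SetLike.mem_coe, Ideal.mem_bot] at hy
      subst hy
      exact h0 hyS
    obtain ⟨q, hq, -, hqS⟩ := Ideal.exists_le_prime_disjoint (⊥ : Ideal KZ.FormalPeriodRing) S hdisj
    -- `q ≤ 𝔭`: an element of `q` of non-zero value would lie in `S` (`b = 0`)
    have hle : q ≤ RingHom.ker KZ.evalP := by
      intro y hy
      rw [RingHom.mem_ker]
      by_contra hy0
      exact Set.disjoint_left.mp hqS hy ⟨y, 0, hy0, by simp⟩
    -- minimality: `𝔭 ≤ q`, so `x ∈ q`; but `x ∈ S`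
    have hge : RingHom.ker KZ.evalP ≤ q := hmin.2 ⟨hq, bot_le⟩ hle
    have hxq : x ∈ q := hge (RingHom.mem_ker.mpr hx)
    exact Set.disjoint_left.mp hqS hxq ⟨1, 1, by rw [map_one]; exact one_ne_zero, by simp⟩

/-- Hence 0541's stub (N) gives genericity in Mathlib's sense through the registered stub as well (consistency with
the landed `ker_evalP_mem_minimalPrimes_of_nilLocalKernel`). [folklore] -/
example (hN : ∀ x : KZ.FormalPeriodRing, KZ.evalP x = 0 →
      ∃ N k : ℕ, KZ.toFormalPeriod (KZ.of KZ.piRep) ^ N * x ^ (k + 1) = 0) :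
    RingHom.ker KZ.evalP ∈ minimalPrimes KZ.FormalPeriodRing :=
  genericPoint_iff_ker_evalP_mem_minimalPrimes.mp (genericPoint_of_nilLocalKernel hN)

/-! ## Position of (D): integrality of `P[ϖ⁻¹]`, and the joint plan for crux 10447 -/

/-- `IsDomain P ⇒` (D) (`N = 0`). [folklore] -/
theorem localisedDomain_of_isDomain (h : IsDomain KZ.FormalPeriodRing) :
    ∀ x y : KZ.FormalPeriodRing, x * y = 0 →
      (∃ N : ℕ, KZ.toFormalPeriod (KZ.of KZ.piRep) ^ N * x = 0) ∨
        (∃ N : ℕ, KZ.toFormalPeriod (KZ.of KZ.piRep) ^ N * y = 0) := by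
  haveI := h
  intro x y hxy
  rcases mul_eq_zero.mp hxy with hx | hy
  · exact Or.inl ⟨0, by rw [hx, mul_zero]⟩
  · exact Or.inr ⟨0, by rw [hy, mul_zero]⟩

/-- **(D) `↔ IsDomain P[ϖ⁻¹]`**: the registered elementwise stub is integrality of the extended algebra
(`x / s · y / t = 0` iff a power of `ϖ` kills `x * y`; `IsLocalization.mk'_surjective`, `map_eq_zero_iff`).
[cite: KontsevichZagier2001, §4.1] -/
theorem localisedDomain_iff_isDomain_away :
    (∀ x y : KZ.FormalPeriodRing, x * y = 0 →
        (∃ N : ℕ, KZ.toFormalPeriod (KZ.of KZ.piRep) ^ N * x = 0) ∨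
          (∃ N : ℕ, KZ.toFormalPeriod (KZ.of KZ.piRep) ^ N * y = 0)) ↔
      IsDomain (Localization.Away (KZ.toFormalPeriod (KZ.of KZ.piRep))) := by
  set p := KZ.toFormalPeriod (KZ.of KZ.piRep) with hp
  constructor
  · intro hD
    haveI : Nontrivial (Localization.Away p) := by
      refine ⟨⟨1, 0, fun h10 => ?_⟩⟩
      rw [← map_one (algebraMap KZ.FormalPeriodRing (Localization.Away p)),
        IsLocalization.map_eq_zero_iff (Submonoid.powers p)] at h10
      obtain ⟨⟨m, N, rfl⟩, hm⟩ := h10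
      exact piClass_pow_ne_zero N (by simpa using hm)
    haveI : NoZeroDivisors (Localization.Away p) := by
      refine ⟨fun {a b} hab => ?_⟩
      obtain ⟨⟨x, s⟩, rfl⟩ := IsLocalization.mk'_surjective (Submonoid.powers p) a
      obtain ⟨⟨y, t⟩, rfl⟩ := IsLocalization.mk'_surjective (Submonoid.powers p) b
      simp only at hab ⊢
      rw [← IsLocalization.mk'_mul, IsLocalization.mk'_eq_zero_iff] at hab
      obtain ⟨⟨m, M, rfl⟩, hm⟩ := hab
      have hm' : (p ^ M * x) * y = 0 := by simpa [mul_assoc] using hm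
      rcases hD _ _ hm' with ⟨N, hN⟩ | ⟨N, hN⟩
      · left
        rw [IsLocalization.mk'_eq_zero_iff]
        exact ⟨⟨_, N + M, rfl⟩, by simpa [pow_add, mul_assoc] using hN⟩
      · right
        rw [IsLocalization.mk'_eq_zero_iff]
        exact ⟨⟨_, N, rfl⟩, hN⟩
    exact NoZeroDivisors.to_isDomain _
  · intro h x y hxy
    haveI := h
    have h0 : algebraMap KZ.FormalPeriodRing (Localization.Away p) x *
        algebraMap KZ.FormalPeriodRing (Localization.Away p) y = 0 := by
      rw [← map_mul, hxy, map_zero]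
    rcases mul_eq_zero.mp h0 with hx | hy
    · exact Or.inl ((piTorsion_iff_algebraMap_eq_zero x).mpr hx)
    · exact Or.inr ((piTorsion_iff_algebraMap_eq_zero y).mpr hy)

/-- `KZ.PiCancellation` in `P`: the disc class kills no non-zero class. [folklore] -/
theorem eq_zero_of_piClass_mul_eq_zero (hP : KZ.PiCancellation) {x : KZ.FormalPeriodRing}
    (hx : KZ.toFormalPeriod (KZ.of KZ.piRep) * x = 0) : x = 0 := by
  obtain ⟨c, rfl⟩ := KZ.toFormalPeriod_surjective x
  rw [← map_mul, KZ.toFormalPeriod_eq_zero_iff] at hx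
  exact KZ.toFormalPeriod_eq_zero_iff.mpr (hP c hx)

/-- `KZ.PiCancellation` in `P`, iterated: powers of the disc class kill no non-zero class. [folklore] -/
theorem eq_zero_of_piClass_pow_mul_eq_zero (hP : KZ.PiCancellation) :
    ∀ (N : ℕ) {x : KZ.FormalPeriodRing}, KZ.toFormalPeriod (KZ.of KZ.piRep) ^ N * x = 0 → x = 0 := by
  intro N
  induction N with
  | zero => intro x hx; simpa using hx
  | succ N ih =>
    intro x hx
    apply ih
    apply eq_zero_of_piClass_mul_eq_zero hP
    rw [← mul_assoc, ← pow_succ', hx]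

/-- Route VietaFibre's child decl of item 0540 is `KZ.PiCancellation` (same term as AyoubSpecialisation's, then
`BetaCancellationLine.stub_ayoubBridge`). [folklore] -/
theorem piCancellation_of_vietaFibre
    (h : Summit.KontsevichZagierPeriods.KontsevichZagierPeriods.Theses.VietaFibre.AyoubPiCancellation) :
    KZ.PiCancellation :=
  Summit.KontsevichZagierPeriods.KontsevichZagierPeriods.BetaCancellationLine.stub_ayoubBridge.mp h

/-- **`IsDomain P ↔ (D) ∧ item 0540`**: the formal period ring is a domain iff its disc-localisation is a domain
and the disc class is a non-zero-divisor — the eval-free leaf of THIS piece and the live item of the OTHER piece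
together are exactly integrality of `P`. [folklore] -/
theorem isDomain_iff_localisedDomain_and_ayoubPiCancellation :
    IsDomain KZ.FormalPeriodRing ↔
      (∀ x y : KZ.FormalPeriodRing, x * y = 0 →
          (∃ N : ℕ, KZ.toFormalPeriod (KZ.of KZ.piRep) ^ N * x = 0) ∨
            (∃ N : ℕ, KZ.toFormalPeriod (KZ.of KZ.piRep) ^ N * y = 0)) ∧
        Summit.KontsevichZagierPeriods.KontsevichZagierPeriods.Theses.VietaFibre.AyoubPiCancellation := by
  constructor
  · intro h
    refine ⟨localisedDomain_of_isDomain h, ?_⟩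
    haveI := h
    refine Summit.KontsevichZagierPeriods.KontsevichZagierPeriods.BetaCancellationLine.stub_ayoubBridge.mpr ?_
    intro c hc
    have h0 : KZ.toFormalPeriod (KZ.of KZ.piRep) * KZ.toFormalPeriod c = 0 := by
      rw [← map_mul]; exact KZ.toFormalPeriod_eq_zero_iff.mpr hc
    rcases mul_eq_zero.mp h0 with h1 | h2
    · exact absurd h1 (by simpa using piClass_pow_ne_zero 1)
    · exact KZ.toFormalPeriod_eq_zero_iff.mp h2
  · rintro ⟨hD, h0540⟩
    have hP := piCancellation_of_vietaFibre h0540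
    haveI : NoZeroDivisors KZ.FormalPeriodRing := ⟨fun {x y} hxy => by
      rcases hD x y hxy with ⟨N, hN⟩ | ⟨N, hN⟩
      · exact Or.inl (eq_zero_of_piClass_pow_mul_eq_zero hP N hN)
      · exact Or.inr (eq_zero_of_piClass_pow_mul_eq_zero hP N hN)⟩
    exact NoZeroDivisors.to_isDomain _

/-- **JOINT PLAN for crux 10447**: `KernelForm ↔ (G) ∧ (D) ∧ AyoubPiCancellation` — the union of the registered
stubs of the two piece skeletons collapses to one transcendence leaf (G) and two eval-free leaves ((D), item 0540),
through `KernelForm ↔ IsDomain P ∧ WeakKernel` (landed `kernelForm_iff_isDomain_and_weakKernel`). [folklore] -/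
theorem kernelForm_iff_genericPoint_and_localisedDomain_and_ayoubPiCancellation :
    Summit.KontsevichZagierPeriods.KontsevichZagierPeriods.Theses.VietaFibre.KernelForm ↔
      (∀ x : KZ.FormalPeriodRing, KZ.evalP x = 0 →
          ∃ s : KZ.FormalPeriodRing, KZ.evalP s ≠ 0 ∧ ∃ k : ℕ, s * x ^ (k + 1) = 0) ∧
        (∀ x y : KZ.FormalPeriodRing, x * y = 0 →
          (∃ N : ℕ, KZ.toFormalPeriod (KZ.of KZ.piRep) ^ N * x = 0) ∨
            (∃ N : ℕ, KZ.toFormalPeriod (KZ.of KZ.piRep) ^ N * y = 0)) ∧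
        Summit.KontsevichZagierPeriods.KontsevichZagierPeriods.Theses.VietaFibre.AyoubPiCancellation := by
  rw [kernelForm_iff_isDomain_and_weakKernel, isDomain_iff_localisedDomain_and_ayoubPiCancellation]
  constructor
  · rintro ⟨⟨hD, h0540⟩, hW⟩
    exact ⟨genericPoint_of_weakKernel hW, hD, h0540⟩
  · rintro ⟨hG, hD, h0540⟩
    exact ⟨⟨hD, h0540⟩, weakKernel_of_stubs hG hD⟩

/-! ## The two stubs are independent over the bare interface

Over ⟨commutative ring `R`, character `e : R →+* ℝ`, element `w` of non-zero value⟩ neither registered stub implies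
the other — so neither implies the piece (which implies both), and a proof of either must use structure of the
Kontsevich–Zagier calculus beyond this interface (compare `model_nil_not_locallyReduced` /
`model_locallyReduced_not_nil` for 0541's nil-cut, p138786). -/

/-- **Model: (G) without (D).** `ℝ × ℝ` with the character `fst` and `w = 1`: the kernel `0 × ℝ` is killed by
`(1, 0)` (value `1`), so the evaluation point is generic; but `(1, 0) · (0, 1) = 0` with neither factor torsion, so
the localisation is not a domain. [folklore] -/
theorem model_generic_not_localisedDomain :
    ∃ (R : Type) (_ : CommRing R) (e : R →+* ℝ) (w : R), e w ≠ 0 ∧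
      (∀ x : R, e x = 0 → ∃ s : R, e s ≠ 0 ∧ ∃ k : ℕ, s * x ^ (k + 1) = 0) ∧
      ¬ (∀ x y : R, x * y = 0 → (∃ N : ℕ, w ^ N * x = 0) ∨ (∃ N : ℕ, w ^ N * y = 0)) := by
  refine ⟨ℝ × ℝ, inferInstance, RingHom.fst ℝ ℝ, 1, by simp, ?_, ?_⟩
  · rintro ⟨a, b⟩ hx
    have ha : a = 0 := by simpa using hx
    refine ⟨(1, 0), by simp, 0, ?_⟩
    subst ha
    ext <;> simp
  · intro h
    rcases h (1, 0) (0, 1) (by ext <;> simp) with ⟨N, hN⟩ | ⟨N, hN⟩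
    · simp at hN
    · simp at hN

/-- **Model: (D) without (G).** `ℝ[X]` with the character `ev₀` and `w = 1`: a domain, so the localisation is a
domain; but `X` has value `0` and `s · X ^ (k+1) = 0` forces `s = 0`, so the evaluation point `(X)` is not generic
(the generic point is `(0)`). [folklore] -/
theorem model_localisedDomain_not_generic :
    ∃ (R : Type) (_ : CommRing R) (e : R →+* ℝ) (w : R), e w ≠ 0 ∧
      (∀ x y : R, x * y = 0 → (∃ N : ℕ, w ^ N * x = 0) ∨ (∃ N : ℕ, w ^ N * y = 0)) ∧
      ¬ (∀ x : R, e x = 0 → ∃ s : R, e s ≠ 0 ∧ ∃ k : ℕ, s * x ^ (k + 1) = 0) := by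
  refine ⟨Polynomial ℝ, inferInstance, Polynomial.evalRingHom 0, 1, by simp, ?_, ?_⟩
  · intro x y hxy
    rcases mul_eq_zero.mp hxy with hx | hy
    · exact Or.inl ⟨0, by simp [hx]⟩
    · exact Or.inr ⟨0, by simp [hy]⟩
  · intro h
    obtain ⟨s, hs, k, hk⟩ := h Polynomial.X (by simp)
    rcases mul_eq_zero.mp hk with h0 | h0
    · exact hs (by simp [h0])
    · exact Polynomial.X_ne_zero ((pow_eq_zero_iff (Nat.succ_ne_zero k)).mp h0)

end Summit.KontsevichZagierPeriods.KontsevichZagierPeriods.Cruxes.KernelForm.AyoubPiLocalKernelPiece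

end
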